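import Literature.MathematicalPhysics.QuantumLattice.HubbardOneParticleCost
import Literature.MathematicalPhysics.QuantumLattice.HubbardBandBottomSector
import HarnessLib

/-!
# The strict two-particle gap `E₂ > 2E₁` of the repulsive Hubbard model (band bottom, part 4)

Topic `Literature/MathematicalPhysics/QuantumLattice` (sub-namespace `HubbardBandBottom`). Written for
route `HubbardSuperconductivity/ParityLeeYang`, support `BandBottomOnAxis` (stmt-HubbardSuperconductivity-8386).

* `isNParticle_zero_eq_smul_vacuum` — a `0`-particle vector is a multiple of `|∅⟩`;
* `sum_numberMode_mulVec` — `Σ_k n(u_k) φ = N φ` on the `N`-particle sector (complete family);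
* `two_particle_structure` — a two-particle vector annihilated by all but two modes `u_{k₁}`,
  `u_{k₂}` of a complete family is a multiple of the Slater state
  `c†(u_{k₁}) c†(u_{k₂}) |∅⟩`;
* `pairState_apply_doublon`, `re_rayleigh_doublon_pairState_pos` — the Slater state of the two spin
  copies `φ ⊗ ↑`, `φ ⊗ ↓` of one site function has amplitude `φ(x)²` on the doublon at `x`, hence
  strictly positive on-site repulsion;
* `two_particle_gap` — for `U > 0` and a simple bottom site eigenvalue, the two-particle sector
  ground energy of `hamiltonian G 1 U` exceeds `2 E₁` strictly.

Everything is proved; no definitions. Source: the standard "two fermions at the band bottom must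
doubly occupy" argument (e.g. Lieb–Wu 2003 §2 for the Perron–Frobenius input).
-/

namespace Literature.MathematicalPhysics.QuantumLattice.HubbardBandBottom

open Matrix Finset Literature.MathematicalPhysics.QuantumLattice
  Literature.MathematicalPhysics.QuantumLattice.RayleighBound
open scoped ComplexOrder

section Generic

variable {ι : Type*} [LinearOrder ι] [Fintype ι] {κ : Type*} [Fintype κ]

omit [Fintype ι] in
/-- A `0`-particle vector is its vacuum amplitude times `|∅⟩`. [folklore] -/
theorem isNParticle_zero_eq_smul_vacuum {φ : Fock ι} (hφ : IsNParticle 0 φ) :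
    φ = φ ∅ • (vacuum : Fock ι) := by
  funext s
  rw [Pi.smul_apply, vacuum, Pi.single_apply, smul_eq_mul]
  by_cases hs : s = ∅
  · subst hs; rw [if_pos rfl, mul_one]
  · rw [if_neg hs, mul_zero, hφ s (fun h => hs (Finset.card_eq_zero.1 h))]

/-- `Σ_k n(u_k) φ = N φ` on the `N`-particle sector, for a complete family `u`. [folklore] -/
theorem sum_numberMode_mulVec (u : κ → ι → ℂ)
    (hu : ∀ i j : ι, ∑ k, u k i * star (u k j) = if i = j then 1 else 0)
    {N : ℕ} {φ : Fock ι} (hφ : IsNParticle N φ) :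
    ∑ k, numberMode (u k) *ᵥ φ = (N : ℂ) • φ := by
  have h := sum_create_mul_annihilate u hu
  simp only [numberMode]
  rw [← Matrix.sum_mulVec, h, totalNumberOp_eq_diagonal]
  funext s
  rw [mulVec_diagonal, Pi.smul_apply, smul_eq_mul]
  by_cases hs : s.card = N
  · rw [hs]
  · rw [hφ s hs, mul_zero, mul_zero]

/-- **Structure of a two-particle vector living in two modes.** If a two-particle `ψ` is
annihilated by `c(u_k)` for every mode `k ∉ {k₁, k₂}` of a complete family, then
`ψ = α · c†(u_{k₁}) c†(u_{k₂}) |∅⟩` with `α = ⟨∅| c(u_{k₂}) c(u_{k₁}) |ψ⟩`. [folklore] -/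
theorem two_particle_structure [DecidableEq κ] (u : κ → ι → ℂ)
    (hu : ∀ i j : ι, ∑ k, u k i * star (u k j) = if i = j then 1 else 0)
    {k₁ k₂ : κ} (hk : k₁ ≠ k₂) {ψ : Fock ι} (hψ : IsNParticle 2 ψ)
    (hann : ∀ k, k ≠ k₁ → k ≠ k₂ → annihilate (u k) *ᵥ ψ = 0) :
    ψ = ((annihilate (u k₂) * annihilate (u k₁)) *ᵥ ψ) ∅ •
      ((create (u k₁) * create (u k₂)) *ᵥ (vacuum : Fock ι)) := by
  -- notation
  set ξ : Fock ι := (annihilate (u k₂) * annihilate (u k₁)) *ᵥ ψ with hξ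
  have hξ0 : IsNParticle 0 ξ := by
    rw [hξ, ← mulVec_mulVec]; exact (hψ.annihilate_mulVec _).annihilate_mulVec _
  have hξvac : ξ = ξ ∅ • (vacuum : Fock ι) := isNParticle_zero_eq_smul_vacuum hξ0
  -- splitting a mode sum into `k₁`, `k₂` and the rest
  have hsplit : ∀ F : κ → Fock ι, (∀ k, k ≠ k₁ → k ≠ k₂ → F k = 0) →
      ∑ k, F k = F k₁ + F k₂ := by
    intro F hF
    rw [← Finset.add_sum_erase _ _ (Finset.mem_univ k₁),
      ← Finset.add_sum_erase _ _ (Finset.mem_erase.2 ⟨hk.symm, Finset.mem_univ k₂⟩),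
      Finset.sum_eq_zero, add_zero]
    intro k hk'
    rw [Finset.mem_erase, Finset.mem_erase] at hk'
    exact hF k hk'.2.1 hk'.1
  have hzero : ∀ φ : Fock ι, (∀ k, k ≠ k₁ → k ≠ k₂ → annihilate (u k) *ᵥ φ = 0) →
      ∀ k, k ≠ k₁ → k ≠ k₂ → numberMode (u k) *ᵥ φ = 0 := by
    intro φ hφ k hk1 hk2
    rw [numberMode, ← mulVec_mulVec, hφ k hk1 hk2, mulVec_zero]
  -- the one-particle vectors `χ₁ = c(u_{k₁}) ψ`, `χ₂ = c(u_{k₂}) ψ`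
  have hann₁ : ∀ k, k ≠ k₁ → k ≠ k₂ → annihilate (u k) *ᵥ (annihilate (u k₁) *ᵥ ψ) = 0 := by
    intro k hk1 hk2
    rw [mulVec_mulVec, annihilate_mul_annihilate, neg_mulVec, ← mulVec_mulVec, hann k hk1 hk2,
      mulVec_zero, neg_zero]
  have hann₂ : ∀ k, k ≠ k₁ → k ≠ k₂ → annihilate (u k) *ᵥ (annihilate (u k₂) *ᵥ ψ) = 0 := by
    intro k hk1 hk2
    rw [mulVec_mulVec, annihilate_mul_annihilate, neg_mulVec, ← mulVec_mulVec, hann k hk1 hk2,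
      mulVec_zero, neg_zero]
  have hχ₁ : annihilate (u k₁) *ᵥ ψ = ξ ∅ • (create (u k₂) *ᵥ vacuum) := by
    have hN := sum_numberMode_mulVec u hu (hψ.annihilate_mulVec (u k₁))
    rw [Nat.cast_one, one_smul, hsplit _ (hzero _ hann₁)] at hN
    -- `n(u_{k₁}) χ₁ = 0` and `n(u_{k₂}) χ₁ = c†(u_{k₂}) ξ`
    have h1 : numberMode (u k₁) *ᵥ (annihilate (u k₁) *ᵥ ψ) = 0 := by
      rw [numberMode, ← mulVec_mulVec, mulVec_mulVec (M := annihilate (u k₁)) (N := annihilate (u k₁)), annihilate_mul_self,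
        zero_mulVec, mulVec_zero]
    have h2 : numberMode (u k₂) *ᵥ (annihilate (u k₁) *ᵥ ψ) = create (u k₂) *ᵥ ξ := by
      rw [numberMode, ← mulVec_mulVec, mulVec_mulVec (M := annihilate (u k₂)) (N := annihilate (u k₁)),
        ← hξ]
    rw [h1, zero_add, h2] at hN
    rw [← hN]
    conv_lhs => rw [hξvac]
    rw [mulVec_smul]
  have hχ₂ : annihilate (u k₂) *ᵥ ψ = -(ξ ∅ • (create (u k₁) *ᵥ vacuum)) := by
    have hN := sum_numberMode_mulVec u hu (hψ.annihilate_mulVec (u k₂))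
    rw [Nat.cast_one, one_smul, hsplit _ (hzero _ hann₂)] at hN
    have h1 : numberMode (u k₁) *ᵥ (annihilate (u k₂) *ᵥ ψ) = -(create (u k₁) *ᵥ ξ) := by
      rw [numberMode, ← mulVec_mulVec, mulVec_mulVec (M := annihilate (u k₁)) (N := annihilate (u k₂)),
        annihilate_mul_annihilate, neg_mulVec, ← hξ, mulVec_neg]
    have h2 : numberMode (u k₂) *ᵥ (annihilate (u k₂) *ᵥ ψ) = 0 := by
      rw [numberMode, ← mulVec_mulVec, mulVec_mulVec (M := annihilate (u k₂)) (N := annihilate (u k₂)), annihilate_mul_self,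
        zero_mulVec, mulVec_zero]
    rw [h1, h2, add_zero] at hN
    rw [← hN]
    conv_lhs => rw [hξvac]
    rw [mulVec_smul]
  -- `2 ψ = c†(u_{k₁}) χ₁ + c†(u_{k₂}) χ₂ = 2 α c†(u_{k₁}) c†(u_{k₂}) |∅⟩`
  have hN := sum_numberMode_mulVec u hu hψ
  rw [hsplit _ (hzero _ hann)] at hN
  have hL : numberMode (u k₁) *ᵥ ψ + numberMode (u k₂) *ᵥ ψ =
      (2 : ℂ) • (ξ ∅ • ((create (u k₁) * create (u k₂)) *ᵥ (vacuum : Fock ι))) := by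
    rw [numberMode, numberMode, ← mulVec_mulVec, ← mulVec_mulVec, hχ₁, hχ₂, mulVec_neg,
      mulVec_smul, mulVec_smul, mulVec_mulVec, mulVec_mulVec, create_mul_create (u k₂) (u k₁),
      neg_mulVec, smul_neg, neg_neg, two_smul]
  rw [hL, Nat.cast_ofNat] at hN
  have h2 := congrArg (fun v : Fock ι => (2 : ℂ)⁻¹ • v) hN
  simp only [smul_smul, inv_mul_cancel₀ (two_ne_zero : (2 : ℂ) ≠ 0), one_smul,
    inv_mul_cancel_left₀ (two_ne_zero : (2 : ℂ) ≠ 0)] at h2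
  exact h2.symm

/-- `c†(g)|∅⟩` has amplitude `g j` on the singleton `{j}`. [folklore] -/
theorem create_mulVec_vacuum_singleton (g : ι → ℂ) (j : ι) :
    (create g *ᵥ (vacuum : Fock ι)) {j} = g j := by
  rw [create_mulVec_apply, Finset.sum_eq_single j]
  · rw [if_pos (Finset.mem_singleton_self j), Finset.erase_singleton, vacuum, Pi.single_eq_same,
      mul_one, jwSign, Finset.filter_eq_empty_iff.2 (fun l hl hlt => ?_), Finset.card_empty,
      pow_zero, mul_one]
    exact absurd (Finset.mem_singleton.1 hl ▸ hlt) (lt_irrefl _)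
  · intro i _ hij
    rw [if_neg (fun h => hij (Finset.mem_singleton.1 h)), mul_zero]
  · exact fun h => absurd (Finset.mem_univ _) h

/-- **Amplitude of a two-mode Slater state on a pair** `{i < j}` when the first mode vanishes at
`j`: `(c†(f) c†(g) |∅⟩)({i, j}) = f(i) g(j)` (the Jordan–Wigner sign is `+1`). [folklore] -/
theorem create_create_vacuum_apply_pair {i j : ι} (hij : i < j) (f g : ι → ℂ) (hf : f j = 0) :
    ((create f * create g) *ᵥ (vacuum : Fock ι)) {i, j} = f i * g j := by
  have hne : i ≠ j := ne_of_lt hij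
  rw [← mulVec_mulVec, create_mulVec_apply, Finset.sum_eq_single i]
  · rw [if_pos (Finset.mem_insert_self i {j}), Finset.erase_insert (by simpa using hne),
      create_mulVec_vacuum_singleton, jwSign, Finset.filter_eq_empty_iff.2, Finset.card_empty,
      pow_zero, one_mul]
    intro l hl hlt
    rcases Finset.mem_insert.1 hl with rfl | hl'
    · exact lt_irrefl _ hlt
    · exact absurd (hij.trans (Finset.mem_singleton.1 hl' ▸ hlt)) (lt_irrefl _)
  · intro l _ hli
    by_cases hlj : l = j
    · subst hlj; rw [hf, zero_mul]
    · rw [if_neg, mul_zero]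
      simp [hli, hlj]
  · exact fun h => absurd (Finset.mem_univ _) h

end Generic

section Hubbard

variable {Λ : Type*} [LinearOrder Λ] [Fintype Λ] (G : SimpleGraph Λ) [DecidableRel G.Adj]

/-- The on-site repulsion of a Fock vector dominates the squared doublon amplitudes:
`Re ⟨Φ, Σ_x n_{x↑}n_{x↓} Φ⟩ ≥ Σ_x |Φ({(x,↑),(x,↓)})|²`. [folklore] -/
theorem sum_norm_sq_doublon_le_re_rayleigh (Φ : Fock (Orb Λ)) :
    ∑ x : Λ, ‖Φ {orb x 0, orb x 1}‖ ^ 2 ≤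
      (star Φ ⬝ᵥ ((∑ x : Λ, creation (orb x 0) * annihilation (orb x 0) *
        (creation (orb x 1) * annihilation (orb x 1))) *ᵥ Φ)).re := by
  rw [Matrix.sum_mulVec, dotProduct_sum, Complex.re_sum]
  refine Finset.sum_le_sum fun x _ => ?_
  have hD : creation (orb x 0) * annihilation (orb x 0) *
      (creation (orb x 1) * annihilation (orb x 1)) = numberOp x 0 * numberOp x 1 := rfl
  rw [hD, numberOp_mul_numberOp_eq_diagonal, dotProduct, Complex.re_sum]
  have hterm : ∀ s : Finset (Orb Λ), 0 ≤ (star Φ s * ((diagonal fun s : Finset (Orb Λ) =>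
      if orb x 0 ∈ s ∧ orb x 1 ∈ s then (1 : ℂ) else 0) *ᵥ Φ) s).re := by
    intro s
    rw [mulVec_diagonal, Pi.star_apply]
    split_ifs
    · rw [one_mul, Complex.star_def, ← Complex.normSq_eq_conj_mul_self]
      exact_mod_cast Complex.normSq_nonneg _
    · simp
  refine le_trans ?_ (Finset.single_le_sum (fun s _ => hterm s) (Finset.mem_univ {orb x 0, orb x 1}))
  rw [Pi.star_apply, mulVec_diagonal, if_pos ⟨Finset.mem_insert_self _ _,
    Finset.mem_insert_of_mem (Finset.mem_singleton_self _)⟩, one_mul, Complex.star_def,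
    ← Complex.normSq_eq_conj_mul_self, Complex.ofReal_re, Complex.normSq_eq_norm_sq]

/-- **Doublon amplitude of the spin-paired Slater state.** For a site function `φ` and the modes
`f = φ ⊗ ↑`, `g = φ ⊗ ↓`, the state `c†(f) c†(g)|∅⟩` has amplitude `φ(x)²` on the doublon at `x`.
[folklore] -/
theorem pairState_apply_doublon (φ : Λ → ℂ) (f g : Orb Λ → ℂ)
    (hf : ∀ o, f o = if (ofLex o).2 = 0 then φ (ofLex o).1 else 0)
    (hg : ∀ o, g o = if (ofLex o).2 = 1 then φ (ofLex o).1 else 0) (x : Λ) :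
    ((create f * create g) *ᵥ (vacuum : Fock (Orb Λ))) {orb x 0, orb x 1} = φ x * φ x := by
  rw [create_create_vacuum_apply_pair (EtaPairingODLRO.orb_zero_lt_orb_one x) f g (by rw [hf]; rfl), hf, hg]
  rfl

/-- **Strict positivity of the on-site repulsion on the spin-paired Slater state** of a nonzero site
function. [folklore] -/
theorem re_rayleigh_doublon_pairState_pos {φ : Λ → ℂ} (hφ : φ ≠ 0) (f g : Orb Λ → ℂ)
    (hf : ∀ o, f o = if (ofLex o).2 = 0 then φ (ofLex o).1 else 0)
    (hg : ∀ o, g o = if (ofLex o).2 = 1 then φ (ofLex o).1 else 0) :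
    0 < (star ((create f * create g) *ᵥ (vacuum : Fock (Orb Λ))) ⬝ᵥ
      ((∑ x : Λ, creation (orb x 0) * annihilation (orb x 0) *
        (creation (orb x 1) * annihilation (orb x 1))) *ᵥ
          ((create f * create g) *ᵥ (vacuum : Fock (Orb Λ))))).re := by
  refine lt_of_lt_of_le ?_ (sum_norm_sq_doublon_le_re_rayleigh _)
  obtain ⟨x, hx⟩ := Function.ne_iff.1 hφ
  refine lt_of_lt_of_le ?_ (Finset.single_le_sum (fun y _ => by positivity) (Finset.mem_univ x))
  rw [pairState_apply_doublon φ f g hf hg x, norm_mul]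
  have : 0 < ‖φ x‖ := norm_pos_iff.2 hx
  positivity

/-- A column of the eigenvector unitary is nonzero. [folklore] -/
theorem eigenvectorUnitary_col_ne_zero {A : Matrix Λ Λ ℂ} (hA : A.IsHermitian) (b : Λ) :
    (fun x => (hA.eigenvectorUnitary : Matrix Λ Λ ℂ) x b) ≠ 0 := by
  classical
  intro h0
  have hU : star (hA.eigenvectorUnitary : Matrix Λ Λ ℂ) * (hA.eigenvectorUnitary : Matrix Λ Λ ℂ)
      = 1 := Matrix.mem_unitaryGroup_iff'.1 hA.eigenvectorUnitary.2
  have h1 := congrFun (congrFun hU b) b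
  rw [Matrix.mul_apply, Matrix.one_apply_eq] at h1
  have h2 : ∑ x, (star (hA.eigenvectorUnitary : Matrix Λ Λ ℂ)) b x *
      (hA.eigenvectorUnitary : Matrix Λ Λ ℂ) x b = 0 :=
    Finset.sum_eq_zero fun x _ => by rw [show (hA.eigenvectorUnitary : Matrix Λ Λ ℂ) x b = 0
      from congrFun h0 x, mul_zero]
  rw [h2] at h1
  exact zero_ne_one h1

/-- `Re ⟨α Φ, D (α Φ)⟩ = |α|² Re ⟨Φ, D Φ⟩`. [folklore] -/
theorem re_rayleigh_smul {m : Type*} [Fintype m] (D : Matrix m m ℂ) (α : ℂ) (Φ : m → ℂ) :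
    (star (α • Φ) ⬝ᵥ (D *ᵥ (α • Φ))).re = ‖α‖ ^ 2 * (star Φ ⬝ᵥ (D *ᵥ Φ)).re := by
  rw [mulVec_smul, star_smul, smul_dotProduct, dotProduct_smul, smul_smul, smul_eq_mul,
    Complex.star_def, ← Complex.normSq_eq_conj_mul_self, Complex.re_ofReal_mul,
    Complex.normSq_eq_norm_sq]

/-- **The strict two-particle gap.** If the site matrix `A` (spin-doubled to `hubbardOneBody G 1 0`)
has a SIMPLE lowest eigenvalue `E₁` with bottom index `b`, then for every `U > 0` the two-particle
sector ground energy of `hamiltonian G 1 U` exceeds `2E₁` strictly: a two-particle state of kinetic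
energy `2E₁` puts both fermions into the two spin copies of the bottom mode, i.e. is the
spin-paired Slater state, which has strictly positive double occupancy. [folklore] -/
theorem two_particle_gap {A : Matrix Λ Λ ℂ} (hA : A.IsHermitian)
    (hhA : ∀ x σ y τ, hubbardOneBody G 1 0 (orb x σ) (orb y τ) = if σ = τ then A x y else 0)
    {b : Λ} (hb : ∀ k, hA.eigenvalues k = A.groundEnergy → k = b) {U : ℝ} (hU : 0 < U)
    (hcard : 1 ≤ Fintype.card Λ) :
    2 * A.groundEnergy < groundEnergyAt G 1 U 2 := by
  classical
  by_contra hle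
  push Not at hle
  obtain ⟨ψ, hψ2, hψ1, hHψ⟩ := ThermodynamicLimit.exists_unit_groundState G 1 U (N := 2) (by omega)
  -- the spin-doubled eigenmodes of the free part
  set u : Orb Λ → Orb Λ → ℂ := fun κ o => if (ofLex o).2 = (ofLex κ).2 then
      (hA.eigenvectorUnitary : Matrix Λ Λ ℂ) (ofLex o).1 (ofLex κ).1 else 0 with hu
  have hu' : ∀ κ o, u κ o = if (ofLex o).2 = (ofLex κ).2 then
      (hA.eigenvectorUnitary : Matrix Λ Λ ℂ) (ofLex o).1 (ofLex κ).1 else 0 := fun κ o => rfl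
  have hcompl := spinModes_complete hA u hu'
  have hon := spinModes_orthonormal hA u hu'
  have heig := spinModes_eigen hA _ hhA u hu'
  set S : Finset (Orb Λ) := {orb b 0, orb b 1} with hS
  have hmemS : ∀ κ : Orb Λ, (ofLex κ).1 = b → κ ∈ S := by
    intro κ hkb
    rw [hS, Finset.mem_insert, Finset.mem_singleton]
    obtain ⟨⟨k, σ⟩, rfl⟩ : ∃ p : Λ × Fin 2, toLex p = κ := ⟨ofLex κ, toLex_ofLex κ⟩
    simp only [ofLex_toLex] at hkb
    subst hkb
    fin_cases σ
    · exact Or.inl rfl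
    · exact Or.inr rfl
  have hE : ∀ κ : Orb Λ, A.groundEnergy ≤ hA.eigenvalues (ofLex κ).1 := fun κ =>
    groundEnergy_le_eigenvalues hA _
  have hSlt : ∀ κ : Orb Λ, κ ∉ S → A.groundEnergy < hA.eigenvalues (ofLex κ).1 := fun κ hκ =>
    lt_of_le_of_ne (hE κ) fun heq => hκ (hmemS κ (hb _ heq.symm))
  -- energies of the sector ground state
  have hnorm : normSq ψ = 1 := by
    have h := star_dotProduct_self_eq_normSq ψ
    rw [hψ1] at h
    exact_mod_cast h.symm
  have hrayH : (star ψ ⬝ᵥ (hamiltonian G 1 U *ᵥ ψ)).re = groundEnergyAt G 1 U 2 := by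
    rw [hHψ, dotProduct_smul, hψ1, smul_eq_mul, mul_one, Complex.ofReal_re]
  have hsplit : (star ψ ⬝ᵥ (hamiltonian G 1 U *ᵥ ψ)).re =
      (star ψ ⬝ᵥ (dGamma (hubbardOneBody G 1 0) *ᵥ ψ)).re + U * (star ψ ⬝ᵥ
        ((∑ x : Λ, creation (orb x 0) * annihilation (orb x 0) *
          (creation (orb x 1) * annihilation (orb x 1))) *ᵥ ψ)).re := by
    conv_lhs => rw [← hamiltonianWith_zero, hamiltonianWith_eq_dGamma_add_smul]
    rw [add_mulVec, dotProduct_add, Complex.add_re, smul_mulVec, dotProduct_smul, smul_eq_mul,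
      Complex.re_ofReal_mul]
  have hpauli := pauli_lower_bound (hubbardOneBody G 1 0) u (fun κ => hA.eigenvalues (ofLex κ).1)
    hcompl (fun κ => by rw [hon, if_pos rfl]) heig le_rfl S hE
    (fun κ _ => by rw [add_zero]; exact hE κ) hψ2
  rw [zero_mul, add_zero, hnorm, mul_one, Nat.cast_two] at hpauli
  -- all particles sit in the bottom modes
  have hdG : (star ψ ⬝ᵥ (dGamma (hubbardOneBody G 1 0) *ᵥ ψ)).re ≤
      (2 : ℕ) * A.groundEnergy * normSq ψ := by
    have := re_rayleigh_doublon_nonneg ψ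
    rw [hnorm, mul_one, Nat.cast_two]
    nlinarith [hrayH, hsplit]
  have hann : ∀ κ, κ ≠ orb b 0 → κ ≠ orb b 1 → annihilate (u κ) *ᵥ ψ = 0 := fun κ h0 h1 =>
    annihilate_mulVec_eq_zero_of_rayleigh_le (hubbardOneBody G 1 0) u
      (fun κ => hA.eigenvalues (ofLex κ).1) hcompl heig S hE hSlt hψ2 hdG
      (by rw [hS, Finset.mem_insert, Finset.mem_singleton]; push Not; exact ⟨h0, h1⟩)
  have hb01 : orb b 0 ≠ orb b 1 := fun h => absurd (orb_eq_orb_iff.1 h).2 (by decide)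
  have hstruct := two_particle_structure u hcompl hb01 hψ2 hann
  set α : ℂ := ((annihilate (u (orb b 1)) * annihilate (u (orb b 0))) *ᵥ ψ) ∅ with hα
  set Φ : Fock (Orb Λ) := (create (u (orb b 0)) * create (u (orb b 1))) *ᵥ vacuum with hΦ
  -- the interaction energy is strictly positive on `ψ = α Φ` ...
  have hφ := eigenvectorUnitary_col_ne_zero hA b
  have hposΦ := re_rayleigh_doublon_pairState_pos hφ (u (orb b 0)) (u (orb b 1))
    (fun o => by rw [hu']; rfl) (fun o => by rw [hu']; rfl)
  have hα0 : α ≠ 0 := by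
    intro h0
    rw [h0, zero_smul] at hstruct
    rw [hstruct, normSq] at hnorm
    simp at hnorm
  have hposψ : 0 < (star ψ ⬝ᵥ ((∑ x : Λ, creation (orb x 0) * annihilation (orb x 0) *
      (creation (orb x 1) * annihilation (orb x 1))) *ᵥ ψ)).re := by
    rw [hstruct, re_rayleigh_smul]
    exact mul_pos (by positivity) hposΦ
  -- ... but the energy balance forces it to be `≤ 0`
  have : U * (star ψ ⬝ᵥ ((∑ x : Λ, creation (orb x 0) * annihilation (orb x 0) *
      (creation (orb x 1) * annihilation (orb x 1))) *ᵥ ψ)).re ≤ 0 := by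
    nlinarith [hrayH, hsplit, hpauli]
  nlinarith [mul_pos hU hposψ]

end Hubbard



end Literature.MathematicalPhysics.QuantumLattice.HubbardBandBottom
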